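import Summits.QuantumFields.YangMills.Theorems.BalabanUVNodesSpineReadingOfRecord13CoPHKRatioDominationBankedChronoOfRecord

/-!
# N20 (NE7b) ON THE TOWER-FREE ROAD, THE FACE OF RECORD WITH THE WINDOWS OF RECORD: ✓`…BankedChronoOfRecord` with the window sequences pinned to def-R's (2.5) sizes of the histories
# of record `R_s = RkOfRecord L r g_s` (the `R_j` of the `𝐃_j` cubes), so (2.5) is a theorem, (2.9) follows from (2.7), and `1 ≤ log g_s⁻²` from `0 < g_s ≤ γ ≤ ½`; displayed after this
# file: (a) the letters · (b) data + labels · (ID) multiplicities + caps · the histories of record in `]0, γ]` obeying (2.7) up to the level + the infrared smallness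
# AT the level · `γ ≤ ½`, `β′ ≥ 0`, `1 + β₀ ≤ L` · the cut — nothing else

Cell `pub-ymgap`, YM-PLAN Track A (HUMAN RULING D-0062); seat `pub-ymgap-dag-n20-d` (R134 (a) N20 NE7b s3), gen 42 — director-ym №374 line (E), road [e] TOWER-FREE of record (№377).
`--kind proof --supports stmt-QuantumFields-27366 --as helper` (K3⁸); COUNT-NEUTRAL; THEOREMS ONLY (0 `def`).  [LF-II] = [Balaban1989LargeFieldII]; [III] = [Balaban1988Convergent].
Companions BY NAME: `…BankedChronoOfRecord.exists_margins_irThreshold_relWeightBound_chronoGenealogies_ofRecord` (gen 42, p781768), def-R's `Node00.RkOfRecord` ∕ `Node00.isRj_RkOfRecord`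
(the (2.5) size of record and its predicate), `B14FlowStep.flowIneq29_of_27` ((2.7) ⇒ (2.9) on (2.5) sizes), `B14FlowStep.log_inv_sq_mono`, `Step.InInterval`, Mathlib's `Real.exp_one_lt_d9`.

WHY.  ✓p781768 displayed per level the window sequence `R K : ℕ → ℕ` with (2.5) `IsRj L r g_s (R K s)`, (2.9) `FlowIneq29 (R K) …` and `1 ≤ log g_s⁻²` as hypotheses.  But the record
HAS its sizes: def-R's `RkOfRecord L r g` ((2.5) p. 255 verbatim: the least power `L^s ≥ (log g⁻²)^r`) is the `R_j` sizing the `𝐃_j` cubes over which the histories of record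
`SeqOfRecord` range (`Node00.DOfRecord`); `isRj_RkOfRecord` proves (2.5) for it (`L ≥ 2`; the family has `L > 11`); `flowIneq29_of_27` derives (2.9) from (2.7) AT THE EXPONENT `r` for
sizes obeying (2.5), given `1 + β₀ ≤ L`, `β′ ≥ 0` and couplings in `]0, γ]`, `γ ≤ 1`; and `0 < g_s ≤ γ ≤ ½` gives `log g_s⁻² ≥ log 4 ≥ 1`.  So three binders become theorems once the
interval hypothesis `Step.InInterval γ (K₀ + K) (histA₁₃ θ K₀ g₀ K)` ([III] Thm 1's «g_k ∈ ]0, γ]») is displayed — the B14 node's own currency; (2.7) at the window exponent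
`r ≤ p₀` (`r(q′+1) < p₀`) DESCENDS from (2.7) at `p₀` along couplings in `]0, 1]` (§1 `flowIneq27_of_exponent_le`: `a^p ≤ c·b^p ⇒ a^r ≤ c·b^r` for `c ≥ 1`).

WHAT IS PROVED (kernel; zero `sorry`).  §1 `pow_le_mul_pow_of_exponent_le`, `flowIneq27_of_exponent_le`.  §2 ★★★ `exists_margins_irThreshold_relWeightBound_chronoGenealogies_ofRecordWindows`
(one composition; `hR` by `isRj_RkOfRecord`, `h27r` by §1, `h29` by `flowIneq29_of_27`, `hx1` by `log_inv_sq_mono` + `log 4 ≥ 1`).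

WHAT STAYS DISPLAYED (the census of road [e] at the carriers of record after this file; NOT PRINTED as theorems of [LF-II] for `d = 4`, NOT proved here): (a) the fibrewise letters with
good images and the factor clause in `C₀`'s raw factors ∕ control costs ∕ windows OF RECORD of the level-read history (an ESTIMATE; junction NC-NE7b-α UNRULED; `pub-balaban`'s R3′);
(b) removal maps, fibre injections, slot filing into the boxes, genealogy LABELS consistent w.r.t. the windows of record ∕ well-formed ∕ pending ∕ chronological ∕ within the caps ∕ rooted
at the slot (DEFINER, post-campaign per №374); (ID) fibre multiplicities `≤ M^{partnerAges}` and caps; (F) `γ ≤ ½`, `β′ K ≥ 0`, `1 + β₀ ≤ L`, the histories of record in `]0, γ]` up to the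
level, (2.7) (exponent `p₀`) up to the level, `x₀ ≤ log g⁻²` AT the level (the B14 node's currency); the cut `j⋆`, `c`; `hP : θ.Provisos₁₃CoPH` (K0⁷); that `C₀, r` are
print's constants and the boxes the birth cells is READING (ID).

HONEST FRAMING.  [bookkeeping]: two elementary real lemmas, one composition; no estimate.  NOTHING of Bałaban's is asserted; NO weight of Bałaban's is bounded; NE7 ∕ NE7b ∕ NE7c NOT PRINTED
for `d = 4` ∕ NOT proved; no `Provisos₁₃CoPH` inhabitant claimed (K0⁷ OPEN); K3⁸ untouched; N20 NOT discharged; counts UNMOVED (typed 28∕28 · discharged 8∕27); one finite four-torus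
programme at fixed `ε` — NOT ℝ⁴, NOT OS, NOT a mass gap, NOT the Clay problem.  No `def`, no `instance`, no `notation`, no `sorry`; no decl below carries a cite tag.
-/

noncomputable section

open MeasureTheory
open scoped BigOperators
open Finset

namespace YMDAG.UVSplit

open Literature.MathematicalPhysics.QuantumFieldTheory.Balaban1983to89
open Literature.MathematicalPhysics.QuantumFieldTheory.Balaban1983to89.T4Continuum
open Literature.MathematicalPhysics.QuantumFieldTheory.Balaban1983to89.Node00
open Literature.MathematicalPhysics.QuantumFieldTheory.Balaban1983to89.B15.BasicStep (fibreIntegral)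
open T4WeightBudget (RelWeightBound)
open T4PersistenceDictionary (Gen PEv dictW)
open T4BankedInduction (Banking credits lifeCost)
open T4PartnerMultiplicity (partnerAges)
open T4BranchingRecordsGas (relabel shape)
open T4PrintedShapeBanking (Consistent)
open T4CanonicalMenus (Chrono fuel canonFam birthMass birthMass_nonneg)

variable {F : T4Family} {N : ℕ} [NeZero N]

/-! ## §1 (2.7) descends to smaller exponents -/

section Exponent

/-- For `a, b ≥ 0`, `c ≥ 1` and `r ≤ p`: `a^p ≤ c·b^p ⇒ a^r ≤ c·b^r` (if `a ≤ b` trivially; else divide by `a^{p−r} ≥ b^{p−r} > 0`). [folklore] -/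
theorem pow_le_mul_pow_of_exponent_le {a b c : ℝ} (ha : 0 ≤ a) (hb : 0 ≤ b) (hc : 1 ≤ c) {r p : ℕ} (hrp : r ≤ p)
    (h : a ^ p ≤ c * b ^ p) : a ^ r ≤ c * b ^ r := by
  rcases le_or_gt a b with hab | hba
  · calc a ^ r ≤ b ^ r := pow_le_pow_left₀ ha hab r
      _ = 1 * b ^ r := (one_mul _).symm
      _ ≤ c * b ^ r := mul_le_mul_of_nonneg_right hc (pow_nonneg hb r)
  · have ha0 : 0 < a := lt_of_le_of_lt hb hba
    have hsplit : ∀ x : ℝ, x ^ p = x ^ r * x ^ (p - r) := fun x => by rw [← pow_add, Nat.add_sub_cancel' hrp]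
    rw [hsplit a, hsplit b] at h
    have hbr : b ^ (p - r) ≤ a ^ (p - r) := pow_le_pow_left₀ hb hba.le _
    have hpos : 0 < a ^ (p - r) := pow_pos ha0 _
    have h2 : c * (b ^ r * b ^ (p - r)) ≤ c * b ^ r * a ^ (p - r) := by
      rw [mul_assoc]
      exact mul_le_mul_of_nonneg_left (mul_le_mul_of_nonneg_left hbr (pow_nonneg hb r)) (le_trans zero_le_one hc)
    exact le_of_mul_le_mul_right (h.trans h2) hpos

/-- **(2.7) AT A SMALLER EXPONENT**: along couplings in `]0, 1]` up to `K` (so every `log g⁻² ≥ 0`) with `β₀, β′ ≥ 0`, (2.7) with exponent `p` implies (2.7) with any exponent `r ≤ p`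
(both members: the constants `1 + β₀ ≥ 1` and `(1 + g_n²β′(n−m))^{β₀} ≥ 1` only help). [cite: Balaban1988Convergent, (2.7) p.255 (bookkeeping)] -/
theorem flowIneq27_of_exponent_le {g : ℕ → ℝ} {β' β₀ : ℝ} {r p K : ℕ} (h27 : B14.FlowIneq27 g β' β₀ p K) (hrp : r ≤ p) (hβ₀ : 0 ≤ β₀)
    (hβ' : 0 ≤ β') (hI : ∀ k, k ≤ K → 0 < g k ∧ g k ≤ 1) : B14.FlowIneq27 g β' β₀ r K := by
  intro m n hmn hn
  obtain ⟨h1, h2⟩ := h27 m n hmn hn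
  have hm := hI m (le_trans hmn.le hn)
  have hn' := hI n hn
  have hLm : 0 ≤ Real.log ((g m) ^ 2)⁻¹ := B14FlowStep.log_inv_sq_nonneg hm.1 hm.2
  have hLn : 0 ≤ Real.log ((g n) ^ 2)⁻¹ := B14FlowStep.log_inv_sq_nonneg hn'.1 hn'.2
  have hX : 0 ≤ (g n) ^ 2 * β' * ((n : ℝ) - m) := by
    have : (0 : ℝ) ≤ (n : ℝ) - m := by
      have : (m : ℝ) ≤ n := by exact_mod_cast hmn.le
      linarith
    positivity
  refine ⟨pow_le_mul_pow_of_exponent_le hLn hLm (by linarith) hrp h1, pow_le_mul_pow_of_exponent_le hLm hLn ?_ hrp h2⟩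
  exact Real.one_le_rpow (by linarith) hβ₀

end Exponent

/-! ## §2 The windows of record: (2.5) a theorem, (2.9) from (2.7) at the exponent `r ≤ p₀`, `1 ≤ log g_s⁻²` from the interval -/

section Windows

open scoped Classical in
/-- ★★★ **THE N20 FACE OF RECORD WITH THE WINDOWS OF RECORD** (✓`…_ofRecord` with three more pins): the window sequences := def-R's (2.5) sizes OF THE HISTORIES OF RECORD,
`R_s = RkOfRecord L r (histA₁₃ θ K₀ g₀ K s)` — the SAME `R_j` that sizes the `𝐃_j` cubes of the histories (`Node00.DOfRecord`) —, so that (2.5) is a theorem (`Node00.isRj_RkOfRecord`,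
`L ≥ 2`), (2.9) follows from (2.7) at the exponent `r` (`B14FlowStep.flowIneq29_of_27`, `1 + β₀ ≤ L`), and `1 ≤ log g_s⁻²` follows from the interval hypothesis `0 < g_s ≤ γ ≤ ½`
(`log 4 ≥ 1`).  For print's valid constants `C₀` (`a, A₀, μ > 0`), `β₀ ≥ 0`, a window exponent `r` with `r(q′+1) < p₀` (reading (ID) intends `r = θ.ν.r`), ANY `M ≥ 0` and `η̄₊ > 0`:
`∃ κ₁ E₀ x₀`, `κ₁, E₀ ≥ 0`, `L^4·e^{η̄₊−κ₁} < 1`, such that for every rank, carrier tuple `(θ, hP, K₀, g₀, os, kr, bd)`, cut, interval bound `γ ≤ ½`, slopes `β′ K ≥ 0`, `1 + β₀ ≤ L`,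
with THE HISTORIES OF RECORD in `]0, γ]` up to the level, obeying (2.7) at the exponent `p₀` up to the level ((2.7) at the window exponent `r ≤ p₀` follows, §1), and the infrared smallness `x₀ ≤ log g⁻²` AT the level; caps;
displayed measurability ∕ integrability; per `(K, t)` EACH RUN's letters (a) (credits of the level-read history, control costs and windows OF RECORD, in `C₀`'s shapes), data and labels
(b) (consistency w.r.t. the windows of record), multiplicities (ID) ⇒ `RelWeightBound 1 … (K ↦ 1 − exp(−S_K))`, `S_K = birthMass C₀·e^{−κ₁}·ℓ^4·ρ^{K − j⋆(K) + 1}∕(1 − ρ)`,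
`ρ = L^4·e^{η̄₊−κ₁}`. [bookkeeping] -/
theorem exists_margins_irThreshold_relWeightBound_chronoGenealogies_ofRecordWindows {X : Type*} (C₀ : T4PrintedShapeBanking.Consts) (hCv : C₀.Valid) (ha : 0 < C₀.a)
    (hA : 0 < C₀.A₀) (hμ₀ : 0 < C₀.μ) {r : ℕ} {β₀ : ℝ} (hβ : 0 ≤ β₀) (hrq : r * (C₀.q' + 1) < C₀.p₀) {M ηplus : ℝ} (hM : 0 ≤ M) (hη : 0 < ηplus) :
    ∃ κ₁ E₀ x₀ : ℝ, 0 ≤ κ₁ ∧ 0 ≤ E₀ ∧ (F.L : ℝ) ^ 4 * Real.exp (ηplus - κ₁) < 1 ∧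
      ∀ {N : ℕ} [NeZero N] (θ : Stage13HParams F N) (hP : θ.Provisos₁₃CoPH F N) (K₀ : ℕ) (g₀ : ℕ → ℝ) (os : List (ULoop F))
      (kr : ℕ → (Σ K, SiteSeqKey F (K₀ + K)) → (Σ K, SiteSeqKey F (K₀ + K))) (bd : ℕ → (Σ K, SiteSeqKey F (K₀ + K)) → Prop) (c : ℝ), 0 < c →
      ∀ (jstar : ℕ → ℕ), (∀ K, jstar K ≤ K) → (∀ K : ℕ, c * K ≤ ((K - jstar K : ℕ) : ℝ)) →
      ∀ (γ : ℝ) (β' : ℕ → ℝ), γ ≤ 1 / 2 → (∀ K, 0 ≤ β' K) → 1 + β₀ ≤ (F.L : ℝ) →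
        (∀ K, Step.InInterval γ (K₀ + K) (histA₁₃ θ K₀ g₀ K)) →
        (∀ K, B14.FlowIneq27 (histA₁₃ θ K₀ g₀ K) (β' K) β₀ C₀.p₀ (K₀ + K)) →
        (∀ K, x₀ ≤ Real.log ((histA₁₃ θ K₀ g₀ K (K₀ + K)) ^ 2)⁻¹) →
      ∀ (Dcap Ncap : ℕ → ℕ),
      (∀ K t s, Measurable fun V => chiSeqOfRecord F N θ.ν θ.τ9.M (histA₁₃ θ K₀ g₀ K) (K₀ + K) (K₀ + K) s V *
        dressedSlotsOfDatum₉ F N θ.toStage9Params (datumOfRecord₁₃CoPH F N θ hP) g₀ os t (runA₁₃ F K₀ g₀ K) (histA₁₃ θ K₀ g₀ K) (K₀ + K) s V) →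
      (∀ K t s, Integrable (fun V => chiSeqOfRecord F N θ.ν θ.τ9.M (histA₁₃ θ K₀ g₀ K) (K₀ + K) (K₀ + K) s V *
        dressedSlotsOfDatum₉ F N θ.toStage9Params (datumOfRecord₁₃CoPH F N θ hP) g₀ os t (runA₁₃ F K₀ g₀ K) (histA₁₃ θ K₀ g₀ K) (K₀ + K) s V)
        (fieldMeasure (F.P (K₀ + K)) (K₀ + K) (SU N))) →
      (∀ K t s', Measurable fun V => chiSeqOfRecord F N θ.ν θ.τ9.M (histB₁₃ θ K₀ g₀ K) (K₀ + K + 1) (K₀ + K + 1) s' V *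
        dressedSlotsOfDatum₉ F N θ.toStage9Params (datumOfRecord₁₃CoPH F N θ hP) g₀ os t (runB₁₃ F K₀ g₀ K) (histB₁₃ θ K₀ g₀ K) (K₀ + K + 1) s' V) →
      (∀ K t s', Integrable (fun V => chiSeqOfRecord F N θ.ν θ.τ9.M (histB₁₃ θ K₀ g₀ K) (K₀ + K + 1) (K₀ + K + 1) s' V *
        dressedSlotsOfDatum₉ F N θ.toStage9Params (datumOfRecord₁₃CoPH F N θ hP) g₀ os t (runB₁₃ F K₀ g₀ K) (histB₁₃ θ K₀ g₀ K) (K₀ + K + 1) s' V)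
        (fieldMeasure (F.P (K₀ + K + 1)) (K₀ + K + 1) (SU N))) →
      (∀ (K : ℕ) (t : ℝ), |t| ≤ 1 →
        ∃ (rm : SeqOfRecord F θ.ν θ.τ9.M (histA₁₃ θ K₀ g₀ K) (K₀ + K) (K₀ + K) → SeqOfRecord F θ.ν θ.τ9.M (histA₁₃ θ K₀ g₀ K) (K₀ + K) (K₀ + K))
          (fib : SeqOfRecord F θ.ν θ.τ9.M (histA₁₃ θ K₀ g₀ K) (K₀ + K) (K₀ + K) → Finset (PBond (F.P (K₀ + K)) (K₀ + K)))
          (z : SeqOfRecord F θ.ν θ.τ9.M (histA₁₃ θ K₀ g₀ K) (K₀ + K) (K₀ + K) → ℝ) (Old : SeqOfRecord F θ.ν θ.τ9.M (histA₁₃ θ K₀ g₀ K) (K₀ + K) (K₀ + K) → Finset X)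
          (φ : SeqOfRecord F θ.ν θ.τ9.M (histA₁₃ θ K₀ g₀ K) (K₀ + K) (K₀ + K) → SeqOfRecord F θ.ν θ.τ9.M (histA₁₃ θ K₀ g₀ K) (K₀ + K) (K₀ + K) → Finset X)
          (slot : X → (Σ _ : ℕ, (Fin 4 → ℕ))) (G : X → Gen PEv),
          (∀ s, kr K (keyA₁₃ θ K₀ g₀ K s) ∈ badClassK₁₃ θ K₀ g₀ kr bd K t → ∀ V,
            fibreIntegral (fib s) (fun V => chiSeqOfRecord F N θ.ν θ.τ9.M (histA₁₃ θ K₀ g₀ K) (K₀ + K) (K₀ + K) s V *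
                dressedSlotsOfDatum₉ F N θ.toStage9Params (datumOfRecord₁₃CoPH F N θ hP) g₀ os t (runA₁₃ F K₀ g₀ K) (histA₁₃ θ K₀ g₀ K) (K₀ + K) s V) V ≤
              z s * fibreIntegral (fib s) (fun V => chiSeqOfRecord F N θ.ν θ.τ9.M (histA₁₃ θ K₀ g₀ K) (K₀ + K) (K₀ + K) (rm s) V *
                dressedSlotsOfDatum₉ F N θ.toStage9Params (datumOfRecord₁₃CoPH F N θ hP) g₀ os t (runA₁₃ F K₀ g₀ K) (histA₁₃ θ K₀ g₀ K) (K₀ + K) (rm s) V) V) ∧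
          (∀ s, kr K (keyA₁₃ θ K₀ g₀ K s) ∈ badClassK₁₃ θ K₀ g₀ kr bd K t → kr K (keyA₁₃ θ K₀ g₀ K (rm s)) ∉ badClassK₁₃ θ K₀ g₀ kr bd K t) ∧
          (∀ σ s, kr K (keyA₁₃ θ K₀ g₀ K s) ∈ badClassK₁₃ θ K₀ g₀ kr bd K t → rm s = σ → φ σ s ⊆ Old σ ∧ (φ σ s).Nonempty) ∧
          (∀ σ, Set.InjOn (φ σ) {s | kr K (keyA₁₃ θ K₀ g₀ K s) ∈ badClassK₁₃ θ K₀ g₀ kr bd K t ∧ rm s = σ}) ∧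
          (∀ σ s, kr K (keyA₁₃ θ K₀ g₀ K s) ∈ badClassK₁₃ θ K₀ g₀ kr bd K t → rm s = σ →
            z s ≤ ∏ Y ∈ φ σ s, Real.exp (-credits (T4PrintedShapeBanking.credit C₀ (fun j => histA₁₃ θ K₀ g₀ K (min j (K₀ + K)))) (G Y)) *
              Real.exp (lifeCost (dictW (fun s => RkOfRecord F.L r (histA₁₃ θ K₀ g₀ K s)) C₀.n₁) (T4PrintedShapeBanking.cost C₀ (K₀ + K) (fun s => RkOfRecord F.L r (histA₁₃ θ K₀ g₀ K s))) (G Y))) ∧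
          (∀ σ, ∀ Y ∈ Old σ, (slot Y).1 < K₀ + jstar K) ∧
          (∀ σ, ∀ Y ∈ Old σ, (slot Y).2 ∈ Fintype.piFinset fun _ : Fin 4 => Finset.range (2 * F.L ^ F.m * F.L ^ ((K₀ + K) - (slot Y).1))) ∧
          (∀ σ, ∀ Y ∈ Old σ, Consistent C₀ (K₀ + K) (fun s => RkOfRecord F.L r (histA₁₃ θ K₀ g₀ K s)) (G Y)) ∧
          (∀ σ, ∀ Y ∈ Old σ, (G Y).WF (dictW (fun s => RkOfRecord F.L r (histA₁₃ θ K₀ g₀ K s)) C₀.n₁)) ∧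
          (∀ σ, ∀ Y ∈ Old σ, K₀ + K < (G Y).reach (dictW (fun s => RkOfRecord F.L r (histA₁₃ θ K₀ g₀ K s)) C₀.n₁)) ∧ (∀ σ, ∀ Y ∈ Old σ, Chrono PEv.step (G Y)) ∧
          (∀ σ, ∀ Y ∈ Old σ, ∀ e ∈ (G Y).events, e.kind = 0 → e.fat < Dcap (K₀ + K)) ∧ (∀ σ, ∀ Y ∈ Old σ, fuel (G Y) ≤ Ncap (K₀ + K)) ∧
          (∀ σ, ∀ Y ∈ Old σ, (G Y).rootStep = (slot Y).1) ∧
          (∀ σ, ∀ j < K₀ + jstar K, ∀ zc ∈ (Fintype.piFinset fun _ : Fin 4 => Finset.range (2 * F.L ^ F.m * F.L ^ ((K₀ + K) - j))),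
            ∀ G₀ ∈ canonFam Dcap Ncap (K₀ + K) j,
            ((((Old σ).filter fun Y => slot Y = ⟨j, zc⟩ ∧ relabel shape (G Y) = G₀).card : ℕ) : ℝ) ≤ M ^ partnerAges PEv.step G₀)) →
      (∀ (K : ℕ) (t : ℝ), |t| ≤ 1 →
        ∃ (rm : SeqOfRecord F θ.ν θ.τ9.M (histB₁₃ θ K₀ g₀ K) (K₀ + K + 1) (K₀ + K + 1) → SeqOfRecord F θ.ν θ.τ9.M (histB₁₃ θ K₀ g₀ K) (K₀ + K + 1) (K₀ + K + 1))
          (fib : SeqOfRecord F θ.ν θ.τ9.M (histB₁₃ θ K₀ g₀ K) (K₀ + K + 1) (K₀ + K + 1) → Finset (PBond (F.P (K₀ + K + 1)) (K₀ + K + 1)))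
          (z : SeqOfRecord F θ.ν θ.τ9.M (histB₁₃ θ K₀ g₀ K) (K₀ + K + 1) (K₀ + K + 1) → ℝ)
          (Old : SeqOfRecord F θ.ν θ.τ9.M (histB₁₃ θ K₀ g₀ K) (K₀ + K + 1) (K₀ + K + 1) → Finset X)
          (φ : SeqOfRecord F θ.ν θ.τ9.M (histB₁₃ θ K₀ g₀ K) (K₀ + K + 1) (K₀ + K + 1) → SeqOfRecord F θ.ν θ.τ9.M (histB₁₃ θ K₀ g₀ K) (K₀ + K + 1) (K₀ + K + 1) → Finset X)
          (slot : X → (Σ _ : ℕ, (Fin 4 → ℕ))) (G : X → Gen PEv),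
          (∀ s', kr K (keyB₁₃ θ K₀ g₀ K s') ∈ badClassK₁₃ θ K₀ g₀ kr bd K t → ∀ V,
            fibreIntegral (fib s') (fun V => chiSeqOfRecord F N θ.ν θ.τ9.M (histB₁₃ θ K₀ g₀ K) (K₀ + K + 1) (K₀ + K + 1) s' V *
                dressedSlotsOfDatum₉ F N θ.toStage9Params (datumOfRecord₁₃CoPH F N θ hP) g₀ os t (runB₁₃ F K₀ g₀ K) (histB₁₃ θ K₀ g₀ K) (K₀ + K + 1) s' V) V ≤
              z s' * fibreIntegral (fib s') (fun V => chiSeqOfRecord F N θ.ν θ.τ9.M (histB₁₃ θ K₀ g₀ K) (K₀ + K + 1) (K₀ + K + 1) (rm s') V *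
                dressedSlotsOfDatum₉ F N θ.toStage9Params (datumOfRecord₁₃CoPH F N θ hP) g₀ os t (runB₁₃ F K₀ g₀ K) (histB₁₃ θ K₀ g₀ K) (K₀ + K + 1) (rm s') V) V) ∧
          (∀ s', kr K (keyB₁₃ θ K₀ g₀ K s') ∈ badClassK₁₃ θ K₀ g₀ kr bd K t → kr K (keyB₁₃ θ K₀ g₀ K (rm s')) ∉ badClassK₁₃ θ K₀ g₀ kr bd K t) ∧
          (∀ σ s', kr K (keyB₁₃ θ K₀ g₀ K s') ∈ badClassK₁₃ θ K₀ g₀ kr bd K t → rm s' = σ → φ σ s' ⊆ Old σ ∧ (φ σ s').Nonempty) ∧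
          (∀ σ, Set.InjOn (φ σ) {s' | kr K (keyB₁₃ θ K₀ g₀ K s') ∈ badClassK₁₃ θ K₀ g₀ kr bd K t ∧ rm s' = σ}) ∧
          (∀ σ s', kr K (keyB₁₃ θ K₀ g₀ K s') ∈ badClassK₁₃ θ K₀ g₀ kr bd K t → rm s' = σ →
            z s' ≤ ∏ Y ∈ φ σ s', Real.exp (-credits (T4PrintedShapeBanking.credit C₀ (fun j => histB₁₃ θ K₀ g₀ K (min j (K₀ + K + 1)))) (G Y)) *
              Real.exp (lifeCost (dictW (fun s => RkOfRecord F.L r (histB₁₃ θ K₀ g₀ K s)) C₀.n₁) (T4PrintedShapeBanking.cost C₀ (K₀ + K + 1) (fun s => RkOfRecord F.L r (histB₁₃ θ K₀ g₀ K s))) (G Y))) ∧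
          (∀ σ, ∀ Y ∈ Old σ, (slot Y).1 < K₀ + jstar K + 1) ∧
          (∀ σ, ∀ Y ∈ Old σ, (slot Y).2 ∈ Fintype.piFinset fun _ : Fin 4 => Finset.range (2 * F.L ^ F.m * F.L ^ ((K₀ + K + 1) - (slot Y).1))) ∧
          (∀ σ, ∀ Y ∈ Old σ, Consistent C₀ (K₀ + K + 1) (fun s => RkOfRecord F.L r (histB₁₃ θ K₀ g₀ K s)) (G Y)) ∧
          (∀ σ, ∀ Y ∈ Old σ, (G Y).WF (dictW (fun s => RkOfRecord F.L r (histB₁₃ θ K₀ g₀ K s)) C₀.n₁)) ∧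
          (∀ σ, ∀ Y ∈ Old σ, K₀ + K + 1 < (G Y).reach (dictW (fun s => RkOfRecord F.L r (histB₁₃ θ K₀ g₀ K s)) C₀.n₁)) ∧ (∀ σ, ∀ Y ∈ Old σ, Chrono PEv.step (G Y)) ∧
          (∀ σ, ∀ Y ∈ Old σ, ∀ e ∈ (G Y).events, e.kind = 0 → e.fat < Dcap (K₀ + K + 1)) ∧ (∀ σ, ∀ Y ∈ Old σ, fuel (G Y) ≤ Ncap (K₀ + K + 1)) ∧
          (∀ σ, ∀ Y ∈ Old σ, (G Y).rootStep = (slot Y).1) ∧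
          (∀ σ, ∀ j < K₀ + jstar K + 1, ∀ zc ∈ (Fintype.piFinset fun _ : Fin 4 => Finset.range (2 * F.L ^ F.m * F.L ^ ((K₀ + K + 1) - j))),
            ∀ G₀ ∈ canonFam Dcap Ncap (K₀ + K + 1) j,
            ((((Old σ).filter fun Y => slot Y = ⟨j, zc⟩ ∧ relabel shape (G Y) = G₀).card : ℕ) : ℝ) ≤ M ^ partnerAges PEv.step G₀)) →
      RelWeightBound 1 (classSetK₁₃ θ K₀ g₀ kr) (weightAK₁₃ θ hP K₀ g₀ os kr) (weightBK₁₃ θ hP K₀ g₀ os kr) (badClassK₁₃ θ K₀ g₀ kr bd)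
        (fun K => 1 - Real.exp (-(birthMass C₀ * Real.exp (-κ₁) * (((2 * F.L ^ F.m : ℕ) : ℝ) ^ 4) *
          ((((F.L : ℝ) ^ 4) * Real.exp (ηplus - κ₁)) ^ (K - jstar K + 1) / (1 - ((F.L : ℝ) ^ 4) * Real.exp (ηplus - κ₁)))))) := by
  have hL2 : 2 ≤ F.L := le_of_lt (lt_trans (by norm_num) F.hL11)
  have hlog4 : (1 : ℝ) ≤ Real.log (((1 / 2 : ℝ) ^ 2)⁻¹) := by
    rw [show (((1 / 2 : ℝ) ^ 2)⁻¹) = 4 by norm_num, Real.le_log_iff_exp_le (by norm_num)]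
    exact Real.exp_one_lt_d9.le.trans (by norm_num)
  obtain ⟨κ₁, E₀, x₀, hκ, hE, hr, hx₀⟩ :=
    exists_margins_irThreshold_relWeightBound_chronoGenealogies_ofRecord (F := F) (X := X) C₀ hCv ha hA hμ₀ hβ hrq hM hη
  refine ⟨κ₁, E₀, x₀, hκ, hE, hr, ?_⟩
  intro N _ θ hP K₀ g₀ os kr bd c hc jstar hjK hfrac γ β' hγ hβ' hβL hI h27 hxK Dcap Ncap hmA hintA hmB hintB hLA hLB
  have hrp : r ≤ C₀.p₀ := (Nat.le_mul_of_pos_right r (Nat.succ_pos _)).trans hrq.le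
  have h27r : ∀ K, B14.FlowIneq27 (histA₁₃ θ K₀ g₀ K) (β' K) β₀ r (K₀ + K) := fun K =>
    flowIneq27_of_exponent_le (h27 K) hrp hβ (hβ' K) fun k hk => ⟨(hI K k hk).1, (hI K k hk).2.trans (hγ.trans (by norm_num))⟩
  have hR : ∀ K s, s ≤ K₀ + K → B14.IsRj F.L r (histA₁₃ θ K₀ g₀ K s) (RkOfRecord F.L r (histA₁₃ θ K₀ g₀ K s)) :=
    fun K s _ => isRj_RkOfRecord hL2 r _
  have h29 : ∀ K, B14FlowStep.FlowIneq29 (fun s => RkOfRecord F.L r (histA₁₃ θ K₀ g₀ K s)) (histA₁₃ θ K₀ g₀ K) F.L (β' K) β₀ (K₀ + K) :=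
    fun K => B14FlowStep.flowIneq29_of_27 hL2 hβ hβL (hβ' K) (hI K) (hγ.trans (by norm_num)) _ (fun j hj => hR K j hj) (h27r K)
  have hx1 : ∀ K s, s ≤ K₀ + K → 1 ≤ Real.log ((histA₁₃ θ K₀ g₀ K s) ^ 2)⁻¹ := fun K s hs =>
    hlog4.trans (B14FlowStep.log_inv_sq_mono (hI K s hs).1 ((hI K s hs).2.trans hγ))
  exact hx₀ θ hP K₀ g₀ os kr bd c hc jstar hjK hfrac (fun K s => RkOfRecord F.L r (histA₁₃ θ K₀ g₀ K s)) β' h27 h29 hR hx1 hxK Dcap Ncap hmA hintA hmB hintB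
    hLA hLB

end Windows

end YMDAG.UVSplit
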